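import Summits.BirchSwinnertonDyer.Rank1Residual.F1Sign2.MarkedTwoSelmerLawAtTwo
import Literature.NumberTheory.EllipticCurves.QuadraticTwist
import HarnessLib.Audit.Tags
import HarnessLib

/-!
# Cell `bsd-f1-sign2` — analytic lens (planner `-an` g21; MEMO-an v1.62-add10/add11/add13 = §24.17, §24.18, §24.21): «THE TWISTED MARKED LAW» —
# 2-Selmer groups in the inert quadratic-twist family (S38r / S38s, KNOWN rows), -an's bookkeeping glue, the MARKED HEEGNER TWIN S38t, and REF1's
# preferred forms S38r♮ / S38t′ — file 1 of 2 (statements only; file 2 = `…TwistedMarkedSelmerLawAtTwoKernel.lean`)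

STATEMENTS ONLY, typer -ty g17 (REF-gated, one file per candidate cluster).  Source: -an g21's cumulative sketch `HOME/MEMO-an-data/g21/an38/lean/Sketch_v65.lean`
**b159c8ff65fcb7b5** (844 l.; = `Sketch_v64` 6a089251e502456e + S38t = `Sketch_v63` 443b65aee50249fa + S38s/glue + S38t; REF1's copies in `HOME/REF1-data/b184/`), block l.779–842
(`section TwistedLaw`: S38r `TwistedSelmerLawInertNegDisc`, S38s `TwistedSelmerLawAllInertNegDisc`, the glue `def TwistedAllInert_implies_Inert`, S38t `MarkedHeegnerTwinExists`)
VERBATIM — decl bodies byte-identical to the sketch AND to REF1's `Probe184.lean` 35a57b4b13d7a799 (builder-verified), namespace `…F1Sign2.ANg21` and `open`s as the landed sibling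
`F1Sign2/MarkedTwoSelmerLawAtTwo.lean` (imported: carrier `markedQuadraticCharacters F θ S`, S38n `TwoSelmerIsMarkedTwoDivisionFieldNegDisc`).  ATTRIBUTES (the one deliberate
deviation, bodies untouched): S38r and S38s are filed as PLAIN `def` KNOWN rows — REF1 §184 grades them TRUE and KNOWN (= [cite: MazurRubin2010, Lemma 2.10, Cor. 3.4] (ii) inert-twist
invariance; their Frobenius clause is vacuous, kernel T184a/T184b/T184b′/C184a/C184b) and REF2 v48 §1 places the twist step IN PRINT («do NOT file S38r/S38s as facts»; VARIANT of
S38n); S38t keeps -an's `@[conjecture]` (TRUE by REF1's print-assembly proof, but as typed — hypothesis `#M(∅) = 2` — it is S38t′ ∘ S38n, and S38n is a conjecture row).  FILED IN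
ADDITION (plain-`def` supports; cell convention «REF1 preferred bodies under REF1's names with kernel glue»): S38r♮ `TwistedSelmerLawInertNegDiscBare` VERBATIM from
`Probe184.lean` l.918–928 (kernel `twistedInert_iff_bare : S38r ↔ S38r♮`), and S38t′ `HeegnerTwinExistsOfTwoSelmerCardTwo` = REF1 rider R184b's retyping of S38t over
`Nat.card (W.selmerGroup 2) = 2` with R184a's clause `D % 8 = 1` (typed by -ty g17 from REF1's text; kernel `markedHeegnerTwin_of_selmerCardTwo : S38t′ → S38n → S38t`).
-an's glue `TwistedAllInert_implies_Inert` (S38s ⟹ S38r; REF1: «true, routine, unproved in v65; left to -ty») is PROVED in the Kernel file (`twistedAllInert_implies_inert`).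
NOT TYPED (words-only at v65, no REF1 verdict): S38u `TwistKernelLawE3` (D-an-134, §24.22; REF2 v49 §3: skeleton IN PRINT), S38v `PinnedTwistLaw` (D-an-135, §24.23; REF2 v49
§4), S38w `MarkedLocalLemmaAtTwo` (D-an-136, §24.24; REF2 v50 §3: PRINT-ASSEMBLY, [cite: BrumerKramer1977, Lemma 3.5]) — -an keeps the character language for the split /
partially-split cells, where `χ(λ)` at a degree-1 `λ ∣ ℓ` is a real condition (REF1 §184 note (1)).
CENSUS = BC5 (MEMO-an §24.17–§24.18, §24.21): ENGINES T1/T2b 6 912/6 912 (S38r: (ℓ inert, Δ < 0) 1 371/1 371), §24.18 all-inert cells 10 112/10 112; S38t: a prime twin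
`ℓ ≤ 131` for 107/124; REF1 FOURTH E-SIDE ENGINE (`REF1-data/b184/data/check184.py` 13028afe841d881a → `out184_all.txt` 675ac431eda3d2ff; 83 098 class curves incl. even
`N`, 8 939/8 939 twists located): inert law 8 184/8 184, prime-Heegner lemma (a) 694/694, L184 689/689.
REF1-AUDIT §184 VERDICT verbatim: «S38r, S38s, S38t: **3/3 SURVIVE, all TRUE, 0 killed — but a DECORATION finding, kernel-certified: the Frobenius clause `χ((ℓ)) = 1` of
S38r/S38s holds for EVERY χ ∈ markedQuadraticCharacters F θ ∅ and every odd ℓ** … so the typed laws ARE «all-inert D ≡ 1 (4) twists preserve #Sel₂» = [Mazur–Rubin 2010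
Lemma 2.10 (ii)(iii)(iv)(v) + Cor 3.4(ii); Kramer 1981] verbatim (arxiv-0904.3709 p0006 L171–198), even as equality of subgroups of H¹(ℚ,E[2]), D ≡ 5 (8) included ⟹
KNOWN rows, not laws. S38t TRUE by print-assembly … riders R184a, R184b.»  REF2-PLACEMENT v48 §1 / §10 (f0b2b1638913f337, a14de702dabf4fbe): S38r/S38s IN PRINT at the twist
step, VARIANT of S38n; S38t PRINT-ASSEMBLY theorem-grade (iterated [cite: MazurRubin2010, Prop. 3.3]), KNOWN-MECHANISM; «Kolyvagin at p = 2» scope for crux idea #4: finiteness IN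
PRINT ([cite: Kolyvagin1990EulerSystems, Thm. A]), every sharp statement printed with `p ≠ 2` ([cite: MatarNekovar2019, §0.3, §0.5, §0.7]; [cite: GrossLMS1991, Prop. 2.1, Prop. 2.3]).
Beyond-print theorem: no.  PARTITION currency unchanged.  BSD is not proved.  bears_on: stmt-BirchSwinnertonDyer-23715.

## -an's section docstring of §24.17 (verbatim, follows)
-/

namespace Summit.BirchSwinnertonDyer.Rank1Residual.F1Sign2.ANg21

open Literature.NumberTheory.EllipticCurves Literature.NumberTheory.EllipticCurves.ModularForms UpperHalfPlane
open Literature.NumberTheory.EllipticCurves.Rank1Residual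
open Summit.BirchSwinnertonDyer.Rank1Residual.F1Sign2 Summit.BirchSwinnertonDyer.Rank1Residual.F1Sign2.ANg17
open Summit.BirchSwinnertonDyer.Rank1Residual.F1Sign2.ANg18 Summit.BirchSwinnertonDyer.Rank1Residual.F1Sign2.ANg19
open Summit.BirchSwinnertonDyer.Rank1Residual.F1Sign2.ANg20
open scoped Classical

/-! ### §24.17 (v63) THE TWISTED MARKED LAW — 2-Selmer groups in the prime quadratic twist family `E^{(ℓ*)}` (ENGINES T1/T2b: 6912/6912)
For `ℓ ∤ 2N` prime, `ℓ* = (−1)^{(ℓ−1)/2} ℓ`, the Selmer group `Sel₂(E^{(ℓ*)}/ℚ)` lives in the same `ker N ⊂ F₃^×/□`; its local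
conditions are those of `E` away from `ℓ` (with the archimedean marking moved to the RIGHTMOST 2-torsion point when `ℓ* < 0`) and, at
`ℓ`, the image of `E[2](ℚ_ℓ)` — «locally trivial» when `ℓ` is inert in `F₃`, and cosets marked by Legendre symbols of root
differences otherwise.  Typed here: the inert case at `Δ < 0` (1371/1371); the general formula is in MEMO-an §24.17. -/
section TwistedLaw
open NumberField

/-- **S38r `TwistedSelmerLawInertNegDisc` (CANDIDATE; T1/T2b 1371/1371 for (ℓ inert, Δ < 0), part of 6912/6912):** class curve `W`
(`N` squarefree, `∏c_p` odd, `E[2](ℚ) = 0`, `Δ < 0`), `F = ℚ(E[2])`, `θ = 4x₁`; `ℓ` an odd prime not dividing `N` which is INERT in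
`F` (the ideal `(ℓ)` of `𝓞 F` is prime).  Then for any elliptic curve `W'` `ℚ`-isomorphic to the quadratic twist `W^{(ℓ*)}`:
`#Sel₂(W'/ℚ) = #{χ ∈ markedQuadraticCharacters F θ ∅ : χ((ℓ)) = 1}` — the marked characters of `E` that are TRIVIAL on the
Frobenius at `ℓ`.  Why it might fail: the local condition of the twist at `ℓ` is `δ(E[2](ℚ_ℓ)) = {1}` (additive reduction,
`E^{ℓ*}(ℚ_ℓ)/2 ≅ E[2](ℚ_ℓ) = 0` when `ℓ` is inert), and «class locally trivial at `(ℓ)`» ⟺ `χ` unramified and split at `(ℓ)`.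
REF1-AUDIT §184 (register 053b448a87fd877e l.3370; evidence `HOME/REF1-data/b184/`): **SURVIVES — TRUE, and KNOWN (Literature-grade): = inert-twist INVARIANCE of `#Sel₂`,
[cite: MazurRubin2010, Lemma 2.10, Cor. 3.4] (ii) + [cite: Kramer1981, Props. 1–3]; the Frobenius clause `χ((ℓ)) = 1` is VACUOUS** — for any odd `ℓ`, EVERY marked quadratic character with
empty archimedean marking takes the value 1 on the principal ideal `(ℓ) = (±ℓ)` with `±ℓ ≡ 1 (mod 4)`, `4 ∈ 𝔭²` for every `𝔭 ∣ 2`, and no sign condition (kernel T184a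
`markedChar_span_natCast_eq_one`, T184b `card_markedChar_frob_eq`, C184a `twistedInert_iff_bare : S38r ↔ S38r♮`, C184b `twistedInert_selmer_eq` (S38n ∧ S38r ⟹
`#Sel₂(W′) = #Sel₂(W)`), Kernel file); so the typed law IS «inert `D ≡ 1 (4)` prime twists preserve `#Sel₂`», even as equality of SUBGROUPS of `H¹(ℚ, E[2])`, `D ≡ 5 (8)`
included (Lemma 2.10 (v)/(iii) do the work there; Cor. 3.4(ii) verbatim wants the primes above 2 split) — a KNOWN row, not a law of the cell; FOURTH E-SIDE ENGINE (REF1, pure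
python, Cremona `allbsd`/`allgens`, 83 098 class curves incl. even `N`, twists located by `(N·D², j, twist class)`): inert law `s₂(E^D) = s₂(E)` **8 184/8 184** (`D ≡ 5 (8)`:
6 458, of which 3 604 with `2 ∣ N` = the Kramer face; 1–3 prime factors); hypothesis mutation: dropping `Odd ∏c_p` breaks it (Lemma 2.10(iii) needs `ord_vΔ` odd),
dropping `Δ < 0` breaks it at `∞` for `D < 0` (Lemma 2.10(iv)); `Squarefree N` needed only as «no additive primes»; `NoRationalTwoTorsion`, `F`, `x₁`, `θ` feed only the
decorative count.  FILED AS A KNOWN SUPPORT ROW (plain `def`; the ONE deliberate deviation from the sketch: -an's `@[conjecture]` attribute is dropped, body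
byte-identical) together with REF1's de-decorated S38r♮ `TwistedSelmerLawInertNegDiscBare` below (REF1: «if you file a Lean row, file S38r♮ or the bare `#Sel₂(W′) =
#Sel₂(W)` form, not the decorated count» — both are here, proved equivalent in the Kernel file).  REF2-PLACEMENT v48 §1 (f0b2b1638913f337): **the twist step is IN PRINT**
— [cite: MazurRubin2010, Lemma 2.10] «criteria for equality of local conditions after twist» (i)–(v) covers every place of ℚ for `W` in the class and all-inert `D ≡ 1 (4)`
coprime to `2N` ((ii) at `v ∣ D`: inert ⟹ `E(ℚ_v)[2] = 0`; (iii) at `v ∣ N`: `∏c_p` odd ⟺ every `ord_p Δ` odd, S38j; (iv) `Δ < 0`; (v) at `v = 2`), hence `Sel₂(W^{(D)}) =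
Sel₂(W)` literally, = [cite: MazurRubin2010, Cor. 3.4] (ii); prime inert twists of semistable odd-conductor `Δ < 0` curves verbatim: [cite: BarrerasalazarPacettiTornaria2021, Thm. 3.3, Remark 3.5];
`χ((ℓ)) = 1` automatic (1.2: `N_{F₃/ℚ}(α) ∈ ℚ^{×2}` reduces to a square mod `ℓ`); as typed the row inherits exactly S38n's status and adds no obligation and no content —
grade VARIANT of S38n; «do NOT file S38r/S38s as Literature facts» (the fact-worthy statement is MR10 Lemma 2.10 itself); PARTITION none; beyond-print theorem: no. -/
def TwistedSelmerLawInertNegDisc : Prop :=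
  ∀ (W : WeierstrassCurve ℚ) [W.IsElliptic] [W.IsGloballyMinimal],
    Squarefree (W.conductorNorm ℤ) → Odd W.tamagawaProduct → NoRationalTwoTorsion W → W.Δ < 0 →
    ∀ (F : Type) [Field F] [NumberField F], IsCubicTwoDivisionField W F →
    ∀ (x₁ : F), (W.baseChange F).twoTorsionPolynomial.toPoly.IsRoot x₁ → ∀ (θ : 𝓞 F), (θ : F) = 4 * x₁ →
    ∀ (ℓ : ℕ), ℓ.Prime → ℓ ≠ 2 → ¬ (ℓ ∣ W.conductorNorm ℤ) → (Ideal.span {(ℓ : 𝓞 F)}).IsPrime →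
    ∀ (W' : WeierstrassCurve ℚ) [W'.IsElliptic],
      (∃ C : WeierstrassCurve.VariableChange ℚ, C • W.quadraticTwist ((-1 : ℚ) ^ ((ℓ - 1) / 2) * ℓ) = W') →
      Nat.card (W'.selmerGroup 2) = Nat.card {χ : Ideal (𝓞 F) → ℤˣ // χ ∈ markedQuadraticCharacters F θ ∅ ∧ χ (Ideal.span {(ℓ : 𝓞 F)}) = 1}

/-- **S38s (general inert case of the TWIST-FAMILY MARKED LAW, §24.18; 10112/10112 twists, the all-inert cells 463+58+627+744 …).**
For `W` in the odd-local squarefree class with `Δ < 0`, `F = ℚ(E[2])` marked by `θ = 4x₁`, and a squarefree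
`D ≡ 1 (mod 4)` coprime to `2N` ALL of whose prime factors are INERT in `F`, every model `W'` of the quadratic twist
`W^{(D)}` has `#Sel₂(W') = #{χ marked quadratic character of F (no archimedean condition) : χ((ℓ)) = 1 for every prime ℓ ∣ D}`.
(Type vector forced to 0; all Frobenius prescriptions trivial; `M(t) = 1 > 0` so the real marking of a `Δ < 0` curve is empty.)
REF1-AUDIT §184: **SURVIVES — TRUE, KNOWN (same as S38r; T184b′ `card_markedChar_allFrob_eq`: every prime factor of `D ≡ 1 (mod 4)` is odd, so the counted set is all of
`M(∅)`)**; the glue `TwistedAllInert_implies_Inert` below («true, routine, unproved in v65; left to -ty») is PROVED in the Kernel file (`twistedAllInert_implies_inert`);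
fourth engine: composite all-inert `D` included in the 8 184/8 184 (288 with two, 5 with three prime factors).  FILED AS A KNOWN SUPPORT ROW (plain `def`, -an's
`@[conjecture]` dropped, body byte-identical).  REF2-PLACEMENT v48 §1.3–1.4: IN PRINT at the twist step ([cite: MazurRubin2010, Lemma 2.10, Cor. 3.4]; composite `D` by the
same place-by-place criteria); VARIANT of S38n; -an's own placement D-an-133 («S38s = S38n + MR10 Prop. 3.3, known mechanism») confirmed and sharpened — no S38n is needed
for the invariance itself; REF1 to -an: keep the character language for the SPLIT / partially-split cells, where a degree-1 `λ ∣ ℓ` makes `χ(λ)` a real condition (S38u /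
S38v territory, words-only at v65, not typed here); beyond-print theorem: no. -/
def TwistedSelmerLawAllInertNegDisc : Prop :=
  ∀ (W : WeierstrassCurve ℚ) [W.IsElliptic] [W.IsGloballyMinimal],
    Squarefree (W.conductorNorm ℤ) → Odd W.tamagawaProduct → NoRationalTwoTorsion W → W.Δ < 0 →
    ∀ (F : Type) [Field F] [NumberField F], IsCubicTwoDivisionField W F →
    ∀ (x₁ : F), (W.baseChange F).twoTorsionPolynomial.toPoly.IsRoot x₁ → ∀ (θ : 𝓞 F), (θ : F) = 4 * x₁ →
    ∀ (D : ℤ), Squarefree D → D % 4 = 1 → IsCoprime D (2 * (W.conductorNorm ℤ : ℤ)) →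
      (∀ ℓ : ℕ, ℓ.Prime → (ℓ : ℤ) ∣ D → (Ideal.span {(ℓ : 𝓞 F)}).IsPrime) →
    ∀ (W' : WeierstrassCurve ℚ) [W'.IsElliptic],
      (∃ C : WeierstrassCurve.VariableChange ℚ, C • W.quadraticTwist (D : ℚ) = W') →
      Nat.card (W'.selmerGroup 2) =
        Nat.card {χ : Ideal (𝓞 F) → ℤˣ // χ ∈ markedQuadraticCharacters F θ ∅ ∧
          ∀ ℓ : ℕ, ℓ.Prime → (ℓ : ℤ) ∣ D → χ (Ideal.span {(ℓ : 𝓞 F)}) = 1}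

/-- S38s specialises to S38r (D = ℓ*): consistency of the two typed laws (bookkeeping about `(-1)^((ℓ-1)/2) * ℓ`).
REF1-AUDIT §184: true, routine bookkeeping (`D := ℓ*`: squarefree, `≡ 1 (4)`, coprime to `2N`, prime factors `{ℓ}`), unproved in v65, «left to -ty» — PROVED by -ty g17:
`twistedAllInert_implies_inert : TwistedAllInert_implies_Inert` (Kernel file, via `primeStar_bookkeeping` + REF1 T184b/T184b′). -/
def TwistedAllInert_implies_Inert : Prop := TwistedSelmerLawAllInertNegDisc → TwistedSelmerLawInertNegDisc

/-- **S38t (MARKED HEEGNER TWIN, §24.18 consequence + Chebotarev; crux idea #4).** For `W` in the odd-local squarefree class with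
`Δ < 0`, analytic rank 1 and marked count 2 (= `Sel₂ = 2`, S38q), there is a squarefree `D < 0`, `D ≡ 1 (mod 4)`, with every prime
`p ∣ N` split in `ℚ(√D)` (Heegner hypothesis: `D` is a nonzero square mod `p`), such that every model `W'` of the twist `W^{(D)}` has
TRIVIAL 2-Selmer group (`Nat.card = 1`): the twin `E^{(D)}` has rank 0, no rational 2-torsion and `Ш[2] = 0`, all read off the
twist-family marked law (type vectors with at least one partially-split prime) — the optimal imaginary quadratic field for a 2-adic
Gross–Zagier–Kolyvagin argument.
REF1-AUDIT §184: **SURVIVES — TRUE by print-assembly (REF1 proof sketch (a)–(d), see S38t′ below), with two typing riders**: **R184a** on the even-`N` face the typed Heegner clause at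
`p = 2`, `∃ s : ZMod 2, s ≠ 0 ∧ s² = D`, holds for EVERY odd `D` (T184c `heegnerClause_at_two_of_odd`, Kernel file) and does NOT say that 2 splits in `ℚ(√D)` (needs
`D ≡ 1 (8)`; `−3 % 8 = 5`, T184d `emod_examples`) — as typed S38t is weaker than the Heegner hypothesis it advertises (harmless for truth, wrong for the GZK use);
**R184b** the hypotheses `W.analyticRank = 1`, `F, x₁, θ`, `#M(∅) = 2` enter only through `d₂(E) = 1`, and `Squarefree N`, `Odd ∏c_p`, `[IsGloballyMinimal]` are not
needed at all — the clean statement is S38t′ `HeegnerTwinExistsOfTwoSelmerCardTwo` (filed below as a plain-`def` support, with R184a's clause `D % 8 = 1`), and **S38t =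
S38t′ ∘ (S38n + GZK) on the class** (glue `markedHeegnerTwin_of_selmerCardTwo : S38t′ → S38n → S38t`, Kernel file; so this row keeps -an's `@[conjecture]` attribute: as
typed, with `#M(∅) = 2` rather than `#Sel₂ = 2` in the hypothesis, it is true MODULO S38n); fourth engine: 589 rank-1 `#Ш_an = 1` class curves with ≥ 1 prime Heegner `q`
in range, 694 pairs — `ψ` has exactly ONE root mod `q` in 694/694 (lemma (a)); REF1's sharp selection rule L184 «`d₂(E^{−q}) = 0` iff `P̄ ∉ 2E(𝔽_q)`, else 2» 689/689
(`pred 0`: 457, e.g. `43a1^{(−3)} = 387e1`, `53a1^{(−7)} = 2597d1`; `pred 2`: 232 = rank 2 ×206 / `#Ш_an = 4` ×24 / 36 ×2; 5 undecided); 409/589 curves already have a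
`Sel₂`-trivial PRIME twin inside the Cremona range.  Novelty (REF1): S38t/S38t′ are KNOWN-MECHANISM (MR10's rank-lowering twist); crux idea #4
`marked-heegner-twin-two-adic-kolyvagin` must earn its grade downstream.  REF2-PLACEMENT v48 §10.2 (a14de702dabf4fbe): **PRINT-ASSEMBLY, theorem-grade** —
[cite: MazurRubin2010, Prop. 3.3] lowers `dim Sel₂` by exactly one on twisting by a prime `ℓ` with `E(ℚ_ℓ)[2] ≅ ℤ/2` at which `loc_ℓ Sel₂(W) ≠ 0` and leaves it unchanged at
inert-type primes; the Frobenius conditions are Čebotarev conditions compatible with «`(D/p) = 1 ∀ p ∣ N`», «`D ≡ 1 (8)`» (at prime level with `v_N(Δ)` odd and `ℓ ≡ 3 (4)`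
quadratic reciprocity gives `(Δ_W/ℓ) = −(N/ℓ)`, so «Heegner for N» ⟹ «exactly one root of the 2-division cubic mod ℓ» automatically — -an's 107/124 prime twins are this
coincidence); caveat: cite MR10 with `D ≡ 1 (8)`; VARIANT of MR10 Thm. 1.4-type existence with Heegner side conditions; §10.1 (exact scope of «Kolyvagin at p = 2» in
print, for crux idea #4): (α) IN PRINT at 2 — `y_K` non-torsion ⟹ rank 1 and `Ш(E/K)` finite with `#Ш[2^∞] ∣ 2^{2m₀} ×` 2-power error terms [cite: Kolyvagin1990EulerSystems, Thm. A];
(β) NOT IN PRINT at 2 — every SHARP statement ([cite: GrossLMS1991, Prop. 2.1, Prop. 2.3] `p ∤ 2D_K`; [cite: MatarNekovar2019, §0.3, §0.5, §0.7] «p ≠ 2»; [cite: WZhang2014, Thm. 1.1]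
`p ≥ 5`); (δ) documented obstruction: `H¹(GL₂(ℤ/2^L), (ℤ/2^M)²) = ℤ/2` (Kolyvagin's error term d); beyond-print theorem: no; PARTITION none; BSD not proved. -/
@[conjecture] def MarkedHeegnerTwinExists : Prop :=
  ∀ (W : WeierstrassCurve ℚ) [W.IsElliptic] [W.IsGloballyMinimal],
    Squarefree (W.conductorNorm ℤ) → Odd W.tamagawaProduct → NoRationalTwoTorsion W → W.Δ < 0 → W.analyticRank = 1 →
    ∀ (F : Type) [Field F] [NumberField F], IsCubicTwoDivisionField W F →
    ∀ (x₁ : F), (W.baseChange F).twoTorsionPolynomial.toPoly.IsRoot x₁ → ∀ (θ : 𝓞 F), (θ : F) = 4 * x₁ →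
    Nat.card (markedQuadraticCharacters F θ ∅) = 2 →
    ∃ D : ℤ, D < 0 ∧ Squarefree D ∧ D % 4 = 1 ∧ IsCoprime D (2 * (W.conductorNorm ℤ : ℤ)) ∧
      (∀ p : ℕ, p.Prime → p ∣ W.conductorNorm ℤ → ∃ s : ZMod p, s ≠ 0 ∧ s ^ 2 = (D : ZMod p)) ∧
      ∀ (W' : WeierstrassCurve ℚ) [W'.IsElliptic],
        (∃ C : WeierstrassCurve.VariableChange ℚ, C • W.quadraticTwist (D : ℚ) = W') → Nat.card (W'.selmerGroup 2) = 1

/-! ### REF1 §184 preferred forms (supports, plain `def`): S38r♮ VERBATIM from `Probe184.lean` l.918–928, and S38t′ = REF1 R184b's retyping of S38t -/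

/-- **S38r♮ (REF1's de-decorated form of S38r): inert prime twists do not change `#Sel₂` — stated, like S38r, with `#M(∅)` on the right.** -/
def TwistedSelmerLawInertNegDiscBare : Prop :=
  ∀ (W : WeierstrassCurve ℚ) [W.IsElliptic] [W.IsGloballyMinimal],
    Squarefree (W.conductorNorm ℤ) → Odd W.tamagawaProduct → NoRationalTwoTorsion W → W.Δ < 0 →
    ∀ (F : Type) [Field F] [NumberField F], IsCubicTwoDivisionField W F →
    ∀ (x₁ : F), (W.baseChange F).twoTorsionPolynomial.toPoly.IsRoot x₁ → ∀ (θ : 𝓞 F), (θ : F) = 4 * x₁ →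
    ∀ (ℓ : ℕ), ℓ.Prime → ℓ ≠ 2 → ¬ (ℓ ∣ W.conductorNorm ℤ) → (Ideal.span {(ℓ : 𝓞 F)}).IsPrime →
    ∀ (W' : WeierstrassCurve ℚ) [W'.IsElliptic],
      (∃ C : WeierstrassCurve.VariableChange ℚ, C • W.quadraticTwist ((-1 : ℚ) ^ ((ℓ - 1) / 2) * ℓ) = W') →
      Nat.card (W'.selmerGroup 2) = Nat.card (markedQuadraticCharacters F θ ∅)


/-- **SUPPORT S38t′ `HeegnerTwinExistsOfTwoSelmerCardTwo` — REF1 §184 rider R184b's clean statement of S38t, typed by -ty g17 exactly as REF1's text** («the hypotheses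
`W.analyticRank = 1`, `F, x₁, θ`, `#M(∅) = 2` enter only through `d₂(E) = 1`, and `Squarefree N`, `Odd ∏c_p`, `[IsGloballyMinimal]` are not needed at all … the clean
statement is S38t′: `∀ W [W.IsElliptic], NoRationalTwoTorsion W → W.Δ < 0 → Nat.card (W.selmerGroup 2) = 2 → ∃ D : ℤ, D < 0 ∧ Squarefree D ∧ D % 8 = 1 ∧ IsCoprime D
(W.conductorNorm ℤ : ℤ) ∧ (∀ p prime, p ∣ W.conductorNorm ℤ → ∃ s : ZMod p, s ≠ 0 ∧ s² = D) ∧ ∀ W' [W'.IsElliptic], (∃ C, C • W.quadraticTwist (D : ℚ) = W') →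
Nat.card (W'.selmerGroup 2) = 1` — no cubic field, no analytic rank, no class hypotheses, and `D = −q` may be taken PRIME; S38t = S38t′ ∘ (S38n + GZK) on the class»;
R184a's clause is built in: `D % 8 = 1` makes 2 SPLIT in `ℚ(√D)`, the Heegner hypothesis at 2 that -an's `D % 4 = 1` + the void `ZMod 2` clause did not express).
REF1 §184 PROOF SKETCH (TRUE, print-assembly): (a) prime Heegner discriminants are transposition primes — the odd-exponent primes of `Δ_min` all divide `N`, so for a
prime `q ≡ 3 (4)` with `(−q|p) = 1 ∀ p ∣ N` (and `q ≡ 7 (8)`) quadratic reciprocity gives `(Δ_E|q) = −1`: `ψ` has exactly one root mod `q`, `E(ℚ_q)[2] ≅ ℤ/2` (694/694);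
(b) for `D = −q` [cite: MazurRubin2010, Lemma 2.10, Lemma 2.11] give equal local conditions at all `v ≠ q` and transversality at `q`, and [cite: MazurRubin2010, Prop. 3.3, Cor. 3.4] (i)
with `T = {q}`: `d₂(E^{−q}) = d₂(E) + 1 − 2·dim loc_q(Sel₂(E))`; (c) `Sel₂(E) = ⟨c⟩`, `ℚ(E[2], c)` has group `E[2] ⋊ S₃ ≅ S₄`, `loc_q(c) ≠ 0` ⟺ `Frob_q` is a 4-cycle;
(d) Čebotarev: the residue conditions live in `K₀ = ℚ(i, √p* : p ∣ N)`, `K₀ ∩ K₁ = ℚ(√−N)`, compatible — a positive density of prime Heegner `q` have `Sel₂(E^{−q}) = 0`.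
REF1's sharp E-side law L184: `d₂(E^{−q}) = 0` iff `P̄ ∉ 2E(𝔽_q)`, else `2` — 689/689 (457 twins with `Sel₂ = 0`, e.g. `43a1^{(−3)} = 387e1`).  Glue
`markedHeegnerTwin_of_selmerCardTwo` (Kernel file): S38t′ ∧ S38n ⟹ -an's S38t verbatim.  REF2-PLACEMENT v48 §10.2: PRINT-ASSEMBLY, theorem-grade = iterated
[cite: MazurRubin2010, Prop. 3.3] with Heegner side conditions (VARIANT of MR10 Thm. 1.4-type existence); KNOWN-MECHANISM — crux idea #4
`marked-heegner-twin-two-adic-kolyvagin` must earn its grade downstream (the 2-adic Kolyvagin step, NOT IN PRINT under full 2-adic image: REF2 v48 §10.1 (β)/(δ)), not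
from S38t; beyond-print theorem: no. -/
def HeegnerTwinExistsOfTwoSelmerCardTwo : Prop :=
  ∀ (W : WeierstrassCurve ℚ) [W.IsElliptic], NoRationalTwoTorsion W → W.Δ < 0 → Nat.card (W.selmerGroup 2) = 2 →
    ∃ D : ℤ, D < 0 ∧ Squarefree D ∧ D % 8 = 1 ∧ IsCoprime D (W.conductorNorm ℤ : ℤ) ∧
      (∀ p : ℕ, p.Prime → p ∣ W.conductorNorm ℤ → ∃ s : ZMod p, s ≠ 0 ∧ s ^ 2 = (D : ZMod p)) ∧
      ∀ (W' : WeierstrassCurve ℚ) [W'.IsElliptic],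
        (∃ C : WeierstrassCurve.VariableChange ℚ, C • W.quadraticTwist (D : ℚ) = W') → Nat.card (W'.selmerGroup 2) = 1

end TwistedLaw

end Summit.BirchSwinnertonDyer.Rank1Residual.F1Sign2.ANg21
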